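import Mathlib
import HarnessLib
import Summits.Schanuel.Schanuel.Theses.RigidCore
import Literature.ModelTheory.ExponentialFields.Languages
import Literature.NumberTheory.Transcendental.ZilberField
import Literature.NumberTheory.Transcendental.KirbyEDerivations
import Literature.NumberTheory.Transcendental.Zilber

/-!
# Sketch — crux-ideate stmt-Schanuel-0968 (AclSubsetLogFreeCore), ideator 3, round 1

First lemmas of three idea cards, stated over existing declarations (no sorry; Props only,
plus two sanity theorems).
-/

noncomputable section

open FirstOrder FirstOrder.Language

namespace Summit.Schanuel.Schanuel.Cruxes.AclSubsetLogFreeCore.Sketch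

open Literature.ModelTheory.ExponentialFields Literature.NumberTheory.Transcendental

/-- `acl^{ℂ_exp}(∅)`: the union of the finite ∅-definable subsets of `(ℂ, +, ·, −, 0, 1, exp)` —
verbatim the hypothesis set-builder of the crux `RigidCore.AclSubsetLogFreeCore`. -/
def expAcl : Set ℂ :=
  {a | ∃ s : Set ℂ, s.Finite ∧ Set.Definable₁ (∅ : Set ℂ) Language.expRing s ∧ a ∈ s}

/-- `dcl^{ℂ_exp}(∅)` (model-theoretic definable closure): the ∅-definable POINTS. -/
def expDclPt : Set ℂ :=
  {a | Set.Definable₁ (∅ : Set ℂ) Language.expRing ({a} : Set ℂ)}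

/-- The log-free core `C_EA` — verbatim the conclusion set-builder of the crux. -/
def logFreeCore : IntermediateField ℚ ℂ :=
  sInf {K : IntermediateField ℚ ℂ | (2 * ↑Real.pi * Complex.I : ℂ) ∈ K ∧
    (∀ w ∈ K, Complex.exp w ∈ K) ∧ ∀ w : ℂ, IsAlgebraic K w → w ∈ K}

/-- Sanity: the crux is literally `expAcl ⊆ logFreeCore`. -/
theorem crux_iff :
    Summit.Schanuel.Schanuel.Theses.RigidCore.AclSubsetLogFreeCore ↔
      ∀ a : ℂ, a ∈ expAcl → a ∈ logFreeCore :=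
  Iff.rfl

/-- F1 (NOTES): the crux is equivalent to its version for ∅-definable POINTS (elementary symmetric
functions of a finite ∅-definable set are ∅-definable points; `C_EA` is relatively algebraically
closed). -/
def CruxIffDcl : Prop :=
  Summit.Schanuel.Schanuel.Theses.RigidCore.AclSubsetLogFreeCore ↔ ∀ a : ℂ, a ∈ expDclPt → a ∈ logFreeCore

/-- F1 (NOTES): ∅-definable points of `ℂ_exp` are real (complex conjugation is an automorphism of
the `expRing`-structure `ℂ`). -/
def DclPtSubsetReal : Prop :=
  expDclPt ⊆ Set.range ((↑) : ℝ → ℂ)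

/-! ## Card A — `eac-prime-model-over-core`: first lemma -/

/-- **First lemma (card A).** If `ℂ_exp` is exponentially-algebraically closed (Zilber's EAC,
tree `IsExpAlgClosed ℂ`; no Schanuel) then every element of a finite ∅-definable set is
exponentially algebraic: `acl^{ℂ_exp}(∅) ⊆ ecl(∅)`. Route to a proof: Bays–Kirby 2018 Thm 11.6 /
Cor. 11.7 with `K = Γcl(∅) = ℚ·ecl ∅` (tree `isQuasiminimal_of_isExpAlgClosed_holds` and its QPS
machinery): uniqueness of the generic type over the closed countable `K` makes every element
outside `ecl ∅` one of uncountably many realisations of one complete type. -/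
def AclSubsetEclOfEAC : Prop :=
  IsExpAlgClosed ℂ → expAcl ⊆ ecl (∅ : Set ℂ)

/-- **Transfer target of card A (CoreRigidity, E-algebra of the countable core).** Every element of
the countable ELA-field `C₀ = ecl(∅)` with only finitely many images under the exponential-ring
automorphisms of `ℂ` lies in the log-free core. (Under EAC every E-field automorphism of `C₀`
extends to `ℂ_exp`, Bays–Kirby categoricity over the base, so this is a statement about
`Aut_E(C₀)`.) -/
def CoreRigidity : Prop :=
  ∀ a : ℂ, a ∈ ecl (∅ : Set ℂ) →
    Set.Finite {b : ℂ | ∃ σ : ℂ ≃+* ℂ, (∀ z : ℂ, σ (Complex.exp z) = Complex.exp (σ z)) ∧ σ a = b} →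
    a ∈ logFreeCore

/-- Assembly of card A: the two pieces give the crux (the implication itself is the content of
Bays–Kirby homogeneity: `acl(∅)` is `Aut(ℂ_exp)`-invariant with finite orbits). -/
def CardA_Assembly : Prop :=
  AclSubsetEclOfEAC → IsExpAlgClosed ℂ → CoreRigidity →
    Summit.Schanuel.Schanuel.Theses.RigidCore.AclSubsetLogFreeCore

/-! ## Card B — `kernel-purity-tarski`: first lemmas -/

/-- **Kernel purity** `KP`: every ∅-definable (in `ℂ_exp`) subset of the kernel `2πiℤ` is, read
through `k ↦ 2πik`, an ∅-definable subset of the ring `(ℤ, +, ·, −, 0, 1)` (i.e. arithmetical).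
The `ℂ`-shadow of Kirby–Zilber 2014 §6 Thm (1) ("`Z` is stably embedded … definable in
`Th(ℤ;+,·)`", there for pseudo-exponential fields under CIT). -/
def KernelPurity : Prop := by
  letI := FirstOrder.Ring.compatibleRingOfRing ℤ
  exact ∀ s : Set ℂ, s ⊆ {z : ℂ | Complex.exp z = 1} →
    Set.Definable₁ (∅ : Set ℂ) Language.expRing s →
      Set.Definable₁ (∅ : Set ℤ) Language.ring {k : ℤ | (2 * ↑Real.pi * Complex.I * (k : ℂ) : ℂ) ∈ s}

/-- **Σ₁-kernel purity** (the provable-now rung of card B): traces on the kernel of sets cut out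
by an EXISTENTIAL `expRing`-formula over ∅ are arithmetical (indeed Σ⁰₃: solvable exponential
systems over computable data have computable solutions). -/
def Sigma1KernelPurity : Prop := by
  letI := FirstOrder.Ring.compatibleRingOfRing ℤ
  exact ∀ (φ : Language.expRing.Formula (Fin 1)), BoundedFormula.IsExistential φ →
    Set.Definable₁ (∅ : Set ℤ) Language.ring
      {k : ℤ | φ.Realize ![(2 * ↑Real.pi * Complex.I * (k : ℂ) : ℂ)]}

/-- The crux's named failure mode: the real line is ∅-definable in `ℂ_exp` (Koiran/Zilber expect
it is not). -/
def RealLineDefinable : Prop :=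
  Set.Definable₁ (∅ : Set ℂ) Language.expRing (Set.range ((↑) : ℝ → ℂ))

/-- **First lemma (card B, Tarski side).** Kernel purity refutes the failure mode: if `ℝ` were
∅-definable then `ℂ_exp` would ∅-interpret second-order arithmetic `(ℝ, +, ·, ℤ)`, whose
∅-definable subsets of `ℤ` include the (non-arithmetical, Tarski) truth set of `(ℤ, +, ·)`. -/
def CardB_Tarski : Prop :=
  KernelPurity → ¬ RealLineDefinable

/-- **First lemma (card B, crux side).** The crux itself already refutes the failure mode,
unconditionally in Schanuel: `ℝ` ∅-definable ⇒ a non-computable real is an ∅-definable point ⇒ it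
lies in `acl(∅)` but not in `C_EA ⊆ ecl(∅) ⊆` computable numbers. -/
def CardB_CruxKillsRealLine : Prop :=
  Summit.Schanuel.Schanuel.Theses.RigidCore.AclSubsetLogFreeCore → ¬ RealLineDefinable

/-! ## Card C — `derivation-flow-sigma1-acl`: first lemma -/

/-- **First lemma (card C).** Every E-derivation of `ℂ_exp` kills every point of a FINITE set
defined over ∅ by an EXISTENTIAL `expRing`-formula; hence (Kirby 2010 Thm 1.1, tree
`Kirby2010_dcl_subset_ecl`) such points are exponentially algebraic. Mechanism: `exp(ε∂)` is an
exponential-ring embedding `ℂ_exp → ℂ[[ε]]_exp`; existential formulas go up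
(`IsExistential.realize_embedding`); Artin approximation turns the formal arc into analytic arcs
inside the (finite-image) definable family, forcing `∂a = 0`. -/
def CardC_Sigma1AclKilledByEDerivations : Prop :=
  ∀ (D : Derivation ℤ ℂ ℂ), IsEDerivation D →
    ∀ (φ : Language.expRing.Formula (Fin 1)), BoundedFormula.IsExistential φ →
      Set.Finite {v : Fin 1 → ℂ | φ.Realize v} →
        ∀ v : Fin 1 → ℂ, φ.Realize v → D (v 0) = 0

/-- Corollary shape of card C: Σ₁-definable finite sets lie in Kirby's `dcl ∅` (derivation
closure), which is `ecl ∅` by Kirby 2010 Thm 1.1. -/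
def CardC_Sigma1AclSubsetDcl : Prop :=
  ∀ (φ : Language.expRing.Formula (Fin 1)), BoundedFormula.IsExistential φ →
    Set.Finite {v : Fin 1 → ℂ | φ.Realize v} →
      ∀ v : Fin 1 → ℂ, φ.Realize v → v 0 ∈ dcl (∅ : Set ℂ)

/-- Sanity: the derivation form gives the `dcl` form (unfolding `dcl`, `eDer`). -/
theorem cardC_dcl_of_derivations (h : CardC_Sigma1AclKilledByEDerivations) :
    CardC_Sigma1AclSubsetDcl := by
  intro φ hφ hfin v hv D hD
  exact h D hD.1 φ hφ hfin v hv

end Summit.Schanuel.Schanuel.Cruxes.AclSubsetLogFreeCore.Sketch
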